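import Summits.QuantumFields.YangMills.Theorems.BalabanUVNodesN09ForwardLawTools
import Summits.QuantumFields.YangMills.Theorems.BalabanUVNodesN09CentralWindowChart
import Summits.QuantumFields.YangMills.Theorems.BalabanUVNodesN09CentralWindowAtRecord
import HarnessLib

/-!
# BalabanUVNodes ∕ N09 — ★★★ THE FORWARD JACOBIAN LAW OF THE ONE-VARIABLE (0.4) FIBRE MAP ON THE CENTRAL `α`-WINDOW, FOR EVERY ENVIRONMENT (global edition of `…N09OneBondForwardLaw`)

Cell `pub-ymgap` (YM-PLAN Track A), width seat `pub-ymgap-dag-n09-w4` g5 (FILE 9 = INTENT-6c); count-neutral helper of K1⁹ = stmt-QuantumFields-27364 (`--supports`, `--as helper`).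
[I] = [Balaban1987RG1].  CONSUMED BY NAME: this seat's g4 `HaarExpChartChangeOfVariables.haar_restrict_image_eq_map_withDensity_jacobian` ([Helgason2000] Ch. I Thm 1.14 + the Euclidean
change of variables), `…N09ForwardLawTools` (chart non-degeneracy, transports), `…N09CentralWindowChart` (geometry, the jointly analytic model, identification), dag-n09-w6 g3's
`…N09CentralWindowAtRecord.avgFun_update_centralBond_injOn_centralWindow` (injectivity on the window) and pub-balaban's `avgFun_update_centralBond_self` (`Ū(U[β(c) ↦ g])(c) = E(pre·g·post)`).

WHAT IS PROVED (0 def, 0 sorry).  `isClosed_centralWindowW` · `fibreMap_injOn_centralWindowW` · ★★★ `forwardLaw_fibreMap_centralWindowW` — for EVERY `U`, every `c` with an off-central index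
`i₀`, `0 ≤ α ≤ 1∕24`, `64·α ≤ δ_N`, `offCard∕|Idx| + 150·α < 1`: `Haar⌊E(S) = E_*(J·Haar⌊S)`, `S = {W | ∀ i, dist1 (fibreFamily U c W i) ≤ α}`,
`J(W) = |det jac(Φ(par, Λ(b⁻¹W)))|·|det D_XΦ(par, Λ(b⁻¹W))| ∕ |det jac(Λ(b⁻¹W))|`, `par = (V(U), ↑b)`, `b = V_{i₀}(U)` · ★★★ `forwardLaw_avgFun_update_centralWindow` — the same in the `g`-variable
on `Ωα c U = {g | ∀ i, dist1 (fibreFamily U c (pre·g·post) i) ≤ α}` for `F(g) = Ū(U[β(c) ↦ g])(c)`: the `hfwd` SHAPE of dag-n09-w6's `exists_perBondCharts_of_forwardLaws` (density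
`jac(g) = J(pre·g·post)`; its positivity on the window and joint measurability are `…N09CentralWindowNondegenerate` ∕ `…N09CentralWindowForwardLawAtRecord`).

HONEST FRAMING.  Count-neutral; classical Lie-group chart calculus ∕ change of variables BY NAME on the tree's typed (0.4) objects; nothing of Bałaban's estimates asserted;
`hreg` NOT discharged; N09 NOT discharged; conjunct 1 (Lemma 4) ∕ FLAG №7 untouched; K0⁷ ∕ K1⁹ ∕ K3⁸ NOT closed; counts unmoved; one finite four-torus programme at fixed
`ε = L^{−K}` — R4 closes the conditional rung `BalabanLadder.UV` only; NOT ℝ⁴ ∕ infinite volume ∕ OS; the Yang–Mills mass gap (Clay) is NOT proved by any of this.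
-/

noncomputable section

open scoped Matrix.Norms.L2Operator Topology ContDiff ENNReal
open Filter Set Function MeasureTheory NormedSpace

namespace Summit.QuantumFields.YangMills.BalabanUVNodes.N09CentralWindowForwardLaw

open Literature.MathematicalPhysics.QuantumFieldTheory.Balaban1983to89
open Literature.MathematicalPhysics.QuantumFieldTheory.Balaban1983to89.HaarExponentialChart
open Literature.MathematicalPhysics.QuantumFieldTheory.Balaban1983to89.HaarExponentialChart.IsChartRep
open Literature.MathematicalPhysics.QuantumFieldTheory.Balaban1983to89.BlockAveraging (Small Idx avgFun loopHol instNonemptyIdx)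
open Literature.MathematicalPhysics.QuantumFieldTheory.Balaban1983to89.BlockAveragingHaarAC (centralBond pre post openHol IsCentral)
open Literature.MathematicalPhysics.QuantumFieldTheory.Balaban1983to89.BlockAveragingEMLHaarAC (fibreFamily fibreMap FibreSmall fibreGuard
  fibreFamily_of_isCentral coe_fibreFamily_of_not_isCentral dist1_fibreFamily_of_not_isCentral fibreMap_of_mem measurable_fibreMap avgFun_update_centralBond_self)
open Literature.MathematicalPhysics.QuantumFieldTheory.Balaban1983to89.ExpMeanLog (eml expMeanLogSU deltaSU)
open Literature.MathematicalPhysics.QuantumFieldTheory.Balaban1983to89.MatrixLog (mlog)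
open Literature.MathematicalPhysics.QuantumFieldTheory.Balaban1983to89.Node00
open Literature.MathematicalPhysics.QuantumLattice (fundamentalRep fundamentalRep_apply)
open Summit.QuantumFields.YangMills.BalabanUVNodes.N09ForwardLawTools
open Summit.QuantumFields.YangMills.BalabanUVNodes.N09CentralWindowChart
open Summit.QuantumFields.YangMills.BalabanUVNodes.N09CentralWindowAtRecord (avgFun_update_centralBond_injOn_centralWindow)

variable {P : Params} {j : ℕ} {N : ℕ} [NeZero N]

/-! ## §1  The W-window is closed; injectivity of the fibre map on it (dag-n09-w6 BY NAME) -/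

section Window

/-- The W-level central `α`-window `{W | ∀ i, dist1 (fibreFamily U c W i) ≤ α}` is closed in `SU(N)`. [cite: Balaban1987RG1, (0.4) p.253 and (2.9) p.266 (bookkeeping)] -/
theorem isClosed_centralWindowW (U : GaugeField P j (SU N)) (c : PBond P (j + 1)) (α : ℝ) :
    IsClosed {W : SU N | ∀ i : Idx P, dist1 (fibreFamily U c W i) ≤ α} := by
  have hset : {W : SU N | ∀ i : Idx P, dist1 (fibreFamily U c W i) ≤ α} = ⋂ i, {W : SU N | dist1 (fibreFamily U c W i) ≤ α} := by
    ext W; simp only [Set.mem_setOf_eq, Set.mem_iInter]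
  rw [hset]
  refine isClosed_iInter fun i => ?_
  by_cases hi : IsCentral c i
  · have : {W : SU N | dist1 (fibreFamily U c W i) ≤ α} = {W : SU N | dist1 (1 : SU N) ≤ α} := by
      ext W; rw [Set.mem_setOf_eq, Set.mem_setOf_eq, fibreFamily_of_isCentral U c W i hi]
    rw [this]
    exact isClosed_const
  · have : {W : SU N | dist1 (fibreFamily U c W i) ≤ α} =
        {W : SU N | ‖((openHol U c i : SU N) : Matrix (Fin N) (Fin N) ℂ) * star (W : Matrix (Fin N) (Fin N) ℂ) - 1‖ ≤ α} := by
      ext W; rw [Set.mem_setOf_eq, Set.mem_setOf_eq, dist1_fibreFamily_of_not_isCentral U c W i hi]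
    rw [this]
    exact isClosed_le ((continuous_const.mul continuous_subtype_val.star).sub continuous_const).norm continuous_const

/-- **The fibre map `E = fibreMap ℰ U c` is injective on the W-window** — dag-n09-w6's `avgFun_update_centralBond_injOn_centralWindow` read through `Ū(U[β(c) ↦ g])(c) = E(pre·g·post)`.
[cite: Balaban1987RG1, (0.4) p.253 and p.267] -/
theorem fibreMap_injOn_centralWindowW (hj : j + 1 ≤ P.m + P.K) (U : GaugeField P j (SU N)) (c : PBond P (j + 1)) {α : ℝ}
    (hα0 : 0 ≤ α) (hα : α ≤ 1 / 24) (hαδ : α < deltaSU (Fin N)) (hgap : (BlockAveragingEMLHaarAC.offCard c : ℝ) / (Fintype.card (Idx P) : ℝ) + 150 * α < 1) :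
    Set.InjOn (fibreMap (expMeanLogSU (n := Fin N)) U c) {W : SU N | ∀ i : Idx P, dist1 (fibreFamily U c W i) ≤ α} := by
  intro W₁ hW₁ W₂ hW₂ heq
  have hinj := avgFun_update_centralBond_injOn_centralWindow (N := N) hj U c hα0 hα hαδ hgap
  have hw : ∀ W : SU N, pre U c * ((pre U c)⁻¹ * W * (post U c)⁻¹) * post U c = W := fun W => by group
  have key : (pre U c)⁻¹ * W₁ * (post U c)⁻¹ = (pre U c)⁻¹ * W₂ * (post U c)⁻¹ := by
    refine hinj ?_ ?_ ?_
    · show ∀ i : Idx P, dist1 (fibreFamily U c (pre U c * ((pre U c)⁻¹ * W₁ * (post U c)⁻¹) * post U c) i) ≤ α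
      rw [hw]; exact hW₁
    · show ∀ i : Idx P, dist1 (fibreFamily U c (pre U c * ((pre U c)⁻¹ * W₂ * (post U c)⁻¹) * post U c) i) ≤ α
      rw [hw]; exact hW₂
    · show avgFun (expMeanLogSU (n := Fin N)) (update U (centralBond c) ((pre U c)⁻¹ * W₁ * (post U c)⁻¹)) c =
        avgFun (expMeanLogSU (n := Fin N)) (update U (centralBond c) ((pre U c)⁻¹ * W₂ * (post U c)⁻¹)) c
      rw [avgFun_update_centralBond_self hj, avgFun_update_centralBond_self hj, hw, hw]; exact heq
  have := congrArg (fun g => pre U c * g * post U c) key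
  simpa only [hw] using this

end Window

/-! ## §2  The forward law of `E = fibreMap ℰ U c` on the W-window, read in ONE chart at `b = V_{i₀}` -/

section Law

variable [MeasurableSpace (specialUnitaryLogChart (Fin N)).lie] [BorelSpace (specialUnitaryLogChart (Fin N)).lie]

/-- ★★★ **THE FORWARD JACOBIAN LAW OF THE ONE-VARIABLE (0.4) FIBRE MAP ON THE CENTRAL `α`-WINDOW, W-LEVEL**: for EVERY environment `U`, coarse bond `c` with an off-central index `i₀`,
and `0 ≤ α ≤ 1∕24`, `64·α ≤ δ_N`, `offCard∕|Idx| + 150·α < 1`: with `E = fibreMap ℰ U c`, `S = {W | ∀ i, dist1 (fibreFamily U c W i) ≤ α}`, `b = V_{i₀}(U)` and the jointly analytic chart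
read `Φ` of `…N09CentralWindowChart` at the parameter `(V(U), ↑b)`:  `Haar⌊E(S) = E_*(J·Haar⌊S)`,
`J(W) = |det jac(Φ(par, Λ(b⁻¹W)))|·|det D_XΦ(par, Λ(b⁻¹W))| ∕ |det jac(Λ(b⁻¹W))|`.  One exponential chart at `b` covers the window (`‖W − b‖ ≤ α`), the chart read is differentiable at
every window point (joint analyticity), injective (dag-n09-w6), and maps into the chart ball (`19α < r_C`); then this seat's g4 `haar_restrict_image_eq_map_withDensity_jacobian` and the
left-translation transport. [cite: Balaban1987RG1, (0.4) p.253 and (2.10) p.267; Helgason2000, Ch. I §1 Thm. 1.14 (12)-(13) p. 96; Balaban1985Averaging, (10) p.19] -/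
theorem forwardLaw_fibreMap_centralWindowW (hj : j + 1 ≤ P.m + P.K) (U : GaugeField P j (SU N)) (c : PBond P (j + 1)) {α : ℝ}
    (hα0 : 0 ≤ α) (hα : α ≤ 1 / 24) (hα64 : 64 * α ≤ deltaSU (Fin N)) (hgap : (BlockAveragingEMLHaarAC.offCard c : ℝ) / (Fintype.card (Idx P) : ℝ) + 150 * α < 1)
    {i₀ : Idx P} (hi₀ : ¬ IsCentral c i₀)
    (EE : (Idx P → Matrix (Fin N) (Fin N) ℂ) → Matrix (Fin N) (Fin N) ℂ → Matrix (Fin N) (Fin N) ℂ)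
    (hEE : ∀ V A, EE V A = eml (fun i : Idx P => if IsCentral c i then (1 : Matrix (Fin N) (Fin N) ℂ) else V i * star A) * A)
    (Φ : ((Idx P → Matrix (Fin N) (Fin N) ℂ) × Matrix (Fin N) (Fin N) ℂ) × (specialUnitaryLogChart (Fin N)).lie → (specialUnitaryLogChart (Fin N)).lie)
    (hΦ : ∀ p, Φ p = HaarExpChartLocal.proj (specialUnitaryLogChart (Fin N))
      (mlog (star (EE p.1.1 p.1.2) * EE p.1.1 (p.1.2 * exp ((p.2 : (specialUnitaryLogChart (Fin N)).lie) : Matrix (Fin N) (Fin N) ℂ))))) :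
    (HaarData.haar : Measure (SU N)).restrict (fibreMap (expMeanLogSU (n := Fin N)) U c '' {W : SU N | ∀ i : Idx P, dist1 (fibreFamily U c W i) ≤ α}) =
      Measure.map (fibreMap (expMeanLogSU (n := Fin N)) U c)
        (((HaarData.haar : Measure (SU N)).restrict {W : SU N | ∀ i : Idx P, dist1 (fibreFamily U c W i) ≤ α}).withDensity fun W =>
          jacDensity (lie_adStable_specialUnitaryGroup (n := Fin N))
              (Φ ((fun i => ((openHol U c i : SU N) : Matrix (Fin N) (Fin N) ℂ), ((openHol U c i₀ : SU N) : Matrix (Fin N) (Fin N) ℂ)),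
                (isChartRep_specialUnitaryGroup (n := Fin N)).logChart ((openHol U c i₀)⁻¹ * W))) *
            ENNReal.ofReal |((fderiv ℝ Φ ((fun i => ((openHol U c i : SU N) : Matrix (Fin N) (Fin N) ℂ), ((openHol U c i₀ : SU N) : Matrix (Fin N) (Fin N) ℂ)),
                (isChartRep_specialUnitaryGroup (n := Fin N)).logChart ((openHol U c i₀)⁻¹ * W))).comp
              (ContinuousLinearMap.inr ℝ ((Idx P → Matrix (Fin N) (Fin N) ℂ) × Matrix (Fin N) (Fin N) ℂ) (specialUnitaryLogChart (Fin N)).lie)).det| /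
            jacDensity (lie_adStable_specialUnitaryGroup (n := Fin N)) ((isChartRep_specialUnitaryGroup (n := Fin N)).logChart ((openHol U c i₀)⁻¹ * W))) := by
  haveI := FieldMeasureExpChartChangeOfVariables.isHaarMeasure_haar_specialUnitaryGroup (N := N)
  -- radii
  obtain ⟨h19r, h38s, h19half, h2αδ, h19one⟩ := radii_of_le_deltaSU (N := N) hα0 hα64
  have hαδ : α < deltaSU (Fin N) := by linarith
  have hαr : α < innerRadius (specialUnitaryLogChart (Fin N)) := by linarith
  have h2αs : 2 * α < chartRadius (specialUnitaryLogChart (Fin N)) := by linarith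
  -- abbreviations (opaque local constants with defining equations)
  obtain ⟨h, hh⟩ : ∃ h', h' = isChartRep_specialUnitaryGroup (n := Fin N) := ⟨_, rfl⟩
  obtain ⟨E, hE⟩ : ∃ E', E' = fibreMap (expMeanLogSU (n := Fin N)) U c := ⟨_, rfl⟩
  obtain ⟨b, hb⟩ : ∃ b', b' = openHol U c i₀ := ⟨_, rfl⟩
  obtain ⟨S, hS⟩ : ∃ S', S' = {W : SU N | ∀ i : Idx P, dist1 (fibreFamily U c W i) ≤ α} := ⟨_, rfl⟩
  obtain ⟨par, hpar⟩ : ∃ par' : (Idx P → Matrix (Fin N) (Fin N) ℂ) × Matrix (Fin N) (Fin N) ℂ,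
      par' = ((fun i => ((openHol U c i : SU N) : Matrix (Fin N) (Fin N) ℂ)), (b : Matrix (Fin N) (Fin N) ℂ)) := ⟨_, rfl⟩
  -- facts on window points
  have hmemS : ∀ {W : SU N}, W ∈ S ↔ ∀ i : Idx P, dist1 (fibreFamily U c W i) ≤ α := by intro W; rw [hS]; rfl
  have f1 : ∀ {W : SU N}, W ∈ S → FibreSmall (expMeanLogSU (n := Fin N)) U c W := fun hW => fibreSmall_of_mem_window U c hαδ (hmemS.1 hW)
  have f2 : ∀ {W : SU N}, W ∈ S → FibreSmall (expMeanLogSU (n := Fin N)) U c b := fun hW => by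
    rw [hb]; exact fibreSmall_openHol_of_mem_window U c hα0 h2αδ (hmemS.1 hW) hi₀
  have f3 : ∀ {W : SU N}, W ∈ S → ‖((b⁻¹ * W : SU N) : Matrix (Fin N) (Fin N) ℂ) - 1‖ ≤ α := fun hW => by
    rw [norm_coe_inv_mul_sub_one, norm_sub_rev, hb]; exact norm_openHol_sub_le_of_mem U c (hmemS.1 hW) hi₀
  have f4 : ∀ {W : SU N}, W ∈ S → b⁻¹ * W ∈ h.window (chartRadius (specialUnitaryLogChart (Fin N))) := fun hW => by
    rw [hh]; exact mem_window_of_norm_sub_one_le (f3 hW) hαr h2αs (by linarith)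
  have f5 : ∀ {W : SU N}, W ∈ S → ‖(((E b)⁻¹ * E W : SU N) : Matrix (Fin N) (Fin N) ℂ) - 1‖ ≤ 19 * α := fun hW => by
    rw [hE, hb]; exact norm_coe_fibreMap_inv_mul_sub_one_le U c hα0 (by linarith) h2αδ (hmemS.1 hW) hi₀
  have f6 : ∀ {W : SU N}, W ∈ S → (E b)⁻¹ * E W ∈ h.window (chartRadius (specialUnitaryLogChart (Fin N))) := fun hW => by
    rw [hh]; exact mem_window_of_norm_sub_one_le (f5 hW) h19r h38s h19half
  have f5' : ∀ {W : SU N}, W ∈ S → ‖fundamentalRep (Fin N) ((E b)⁻¹ * E W) - 1‖ < innerRadius (specialUnitaryLogChart (Fin N)) := fun hW => by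
    rw [fundamentalRep_apply]; exact (f5 hW).trans_lt h19r
  -- the chart-level objects
  obtain ⟨Ω, hΩ⟩ : ∃ Ω' : Set (specialUnitaryLogChart (Fin N)).lie,
      Ω' = {X | X ∈ Metric.ball (0 : (specialUnitaryLogChart (Fin N)).lie) (chartRadius (specialUnitaryLogChart (Fin N))) ∧ b * h.expChart X ∈ S} := ⟨_, rfl⟩
  have hmemΩ : ∀ {X}, X ∈ Ω ↔ X ∈ Metric.ball (0 : (specialUnitaryLogChart (Fin N)).lie) (chartRadius (specialUnitaryLogChart (Fin N))) ∧ b * h.expChart X ∈ S := by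
    intro X; rw [hΩ]; rfl
  obtain ⟨σ, hσ⟩ : ∃ σ' : (specialUnitaryLogChart (Fin N)).lie → (specialUnitaryLogChart (Fin N)).lie, σ' = fun X => Φ (par, X) := ⟨_, rfl⟩
  obtain ⟨Ψ₁, hΨ₁⟩ : ∃ Ψ' : SU N → SU N, Ψ' = fun k => (E b)⁻¹ * E (b * k) := ⟨_, rfl⟩
  -- the slice is the chart read, and the semiconjugacy
  have hslice : ∀ {X}, X ∈ Ω → σ X = h.logChart (Ψ₁ (h.expChart X)) := by
    intro X hX
    have hW := (hmemΩ.1 hX).2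
    rw [hσ, hΨ₁, hpar, hh, hE]
    show Φ (((fun i => ((openHol U c i : SU N) : Matrix (Fin N) (Fin N) ℂ)), (b : Matrix (Fin N) (Fin N) ℂ)), X) = _
    refine modelChart_apply_eq_logChart U c EE hEE Φ hΦ (f2 hW) ?_ ?_
    · rw [← hh]; exact f1 hW
    · have := f5' hW; rw [fundamentalRep_apply, hE, hh] at this; exact this
  have hsemi : ∀ X ∈ Ω, Ψ₁ (h.expChart X) = h.expChart (σ X) := by
    intro X hX
    have hW := (hmemΩ.1 hX).2
    have := f5' hW
    rw [hh] at this
    rw [hslice hX, hh, (isChartRep_specialUnitaryGroup (n := Fin N)).expChart_logChart (by rw [hΨ₁]; exact this)]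
  -- differentiability of `Φ` at `(par, X)`, `X ∈ Ω`, and the derivative of the slice
  have hΦd : ∀ {X}, X ∈ Ω → ContDiffAt ℝ ⊤ Φ (par, X) := by
    intro X hX
    have hW := (hmemΩ.1 hX).2
    rw [hpar]
    refine contDiffAt_modelChart c EE hEE Φ hΦ ?_ ?_ ?_
    · intro i hi
      rw [norm_coe_mul_star_sub_one]
      have h2 := norm_openHol_sub_openHol_le U c (hmemS.1 hW) hi hi₀
      rw [← hb] at h2
      linarith
    · intro i hi
      have hcoe : (b : Matrix (Fin N) (Fin N) ℂ) * exp ((X : (specialUnitaryLogChart (Fin N)).lie) : Matrix (Fin N) (Fin N) ℂ) =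
          ((b * h.expChart X : SU N) : Matrix (Fin N) (Fin N) ℂ) := by
        rw [Submonoid.coe_mul, hh, coe_expChart_SU]
      rw [hcoe, norm_coe_mul_star_sub_one]
      exact (norm_openHol_sub_le_of_mem U c (hmemS.1 hW) hi).trans_lt (by linarith)
    · have hXs : FibreSmall (expMeanLogSU (n := Fin N)) U c (b * (isChartRep_specialUnitaryGroup (n := Fin N)).expChart X) := by
        rw [← hh]; exact f1 hW
      rw [star_modelE_mul_modelE_eq_coe U c EE hEE (f2 hW) hXs]
      have h5 := f5 hW
      rw [hE, hh] at h5
      exact h5.trans_lt h19one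
  have hσd : ∀ {X}, X ∈ Ω → HasFDerivAt σ ((fderiv ℝ Φ (par, X)).comp
      (ContinuousLinearMap.inr ℝ ((Idx P → Matrix (Fin N) (Fin N) ℂ) × Matrix (Fin N) (Fin N) ℂ) (specialUnitaryLogChart (Fin N)).lie)) X := by
    intro X hX
    rw [hσ]
    exact ((hΦd hX).differentiableAt (by simp)).hasFDerivAt.comp X (hasFDerivAt_prodMk_right par X)
  -- the hypotheses of the change-of-variables theorem
  have hΩm : MeasurableSet Ω := by
    have hc : Continuous fun X : (specialUnitaryLogChart (Fin N)).lie => b * h.expChart X := by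
      rw [hh]; exact continuous_const.mul (isChartRep_specialUnitaryGroup (n := Fin N)).continuous_expChart
    have hSc : IsClosed S := by rw [hS]; exact isClosed_centralWindowW U c α
    rw [hΩ]
    exact Metric.isOpen_ball.measurableSet.inter (hSc.preimage hc).measurableSet
  have hΩs : Ω ⊆ Metric.ball (0 : (specialUnitaryLogChart (Fin N)).lie) (chartRadius (specialUnitaryLogChart (Fin N))) := fun X hX => (hmemΩ.1 hX).1
  have hjac : ∀ X ∈ Ω, LinearMap.det (B13HaarSigmaJacobian.jac (lie_adStable_specialUnitaryGroup (n := Fin N)) X :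
      (specialUnitaryLogChart (Fin N)).lie →ₗ[ℝ] (specialUnitaryLogChart (Fin N)).lie) ≠ 0 := fun X hX => by
    refine det_jac_ne_zero_of_norm_le_half (lie_adStable_specialUnitaryGroup (n := Fin N)) ?_
    have h1 := mem_ball_zero_iff.1 (hΩs hX)
    linarith [chartRadius_le_innerRadius (C := specialUnitaryLogChart (Fin N)), innerRadius_le_half (C := specialUnitaryLogChart (Fin N))]
  have hψ' : ∀ X ∈ Ω, HasFDerivWithinAt σ ((fderiv ℝ Φ (par, X)).comp
      (ContinuousLinearMap.inr ℝ ((Idx P → Matrix (Fin N) (Fin N) ℂ) × Matrix (Fin N) (Fin N) ℂ) (specialUnitaryLogChart (Fin N)).lie)) Ω X :=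
    fun X hX => (hσd hX).hasFDerivWithinAt
  have hinj : Set.InjOn σ Ω := by
    intro X hX X' hX' hXX'
    have hW := (hmemΩ.1 hX).2
    have hW' := (hmemΩ.1 hX').2
    have e1 : Ψ₁ (h.expChart X) = Ψ₁ (h.expChart X') := by rw [hsemi X hX, hsemi X' hX', hXX']
    have e2 : E (b * h.expChart X) = E (b * h.expChart X') := by
      rw [hΨ₁] at e1; exact mul_left_cancel e1
    have e3 : b * h.expChart X = b * h.expChart X' := by
      rw [hE] at e2
      exact fibreMap_injOn_centralWindowW (N := N) hj U c hα0 hα hαδ hgap (hmemS.1 hW) (hmemS.1 hW') e2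
    have e4 : h.expChart X = h.expChart X' := mul_left_cancel e3
    rw [hh] at e4
    exact (isChartRep_specialUnitaryGroup (n := Fin N)).injOn_expChart le_rfl (hΩs hX) (hΩs hX') e4
  have hmaps : Set.MapsTo σ Ω (Metric.ball (0 : (specialUnitaryLogChart (Fin N)).lie) (chartRadius (specialUnitaryLogChart (Fin N)))) := by
    intro X hX
    have h6 := f6 (hmemΩ.1 hX).2
    rw [hh] at h6
    rw [hslice hX, hh]
    refine (isChartRep_specialUnitaryGroup (n := Fin N)).logChart_mem_ball le_rfl ?_
    rw [hΨ₁]; exact h6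
  have hsemi' : ∀ X ∈ Ω, Ψ₁ ((isChartRep_specialUnitaryGroup (n := Fin N)).expChart X) = (isChartRep_specialUnitaryGroup (n := Fin N)).expChart (σ X) := by
    intro X hX; have := hsemi X hX; rwa [hh] at this
  -- the change of variables at the identity
  have hlaw₁ := (isChartRep_specialUnitaryGroup (n := Fin N)).haar_restrict_image_eq_map_withDensity_jacobian
    (lie_adStable_specialUnitaryGroup (n := Fin N)) (HaarData.haar : Measure (SU N)) chartRadius_pos le_rfl hΩm hΩs hjac hψ' hinj hmaps hsemi'
  -- `Θ(Ω) = b⁻¹·S`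
  have himg : (isChartRep_specialUnitaryGroup (n := Fin N)).expChart '' Ω = (fun W : SU N => b⁻¹ * W) '' S := by
    ext k
    constructor
    · rintro ⟨X, hX, rfl⟩
      refine ⟨b * h.expChart X, (hmemΩ.1 hX).2, ?_⟩
      show b⁻¹ * (b * h.expChart X) = (isChartRep_specialUnitaryGroup (n := Fin N)).expChart X
      rw [inv_mul_cancel_left, hh]
    · rintro ⟨W, hW, rfl⟩
      have hk := f4 hW
      rw [hh] at hk
      refine ⟨(isChartRep_specialUnitaryGroup (n := Fin N)).logChart (b⁻¹ * W), hmemΩ.2 ⟨?_, ?_⟩, ?_⟩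
      · exact (isChartRep_specialUnitaryGroup (n := Fin N)).logChart_mem_ball le_rfl hk
      · rw [hh, (isChartRep_specialUnitaryGroup (n := Fin N)).expChart_logChart_of_mem_window le_rfl hk, mul_inv_cancel_left]; exact hW
      · exact (isChartRep_specialUnitaryGroup (n := Fin N)).expChart_logChart_of_mem_window le_rfl hk
  rw [himg] at hlaw₁
  -- transport from the identity to the window (left translations)
  have hEm : Measurable E := by rw [hE]; exact measurable_fibreMap _ ExpMeanLog.measurable_expMeanLogSU_E U c
  have hlaw₂ := forwardLaw_of_forwardLaw_at_one (HaarData.haar : Measure (SU N)) b (E b) _ (fun k => by rw [hΨ₁]) hEm hlaw₁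
  subst hE hS hσ hpar hb hh
  exact hlaw₂

/-- ★★★ **THE FORWARD JACOBIAN LAW IN THE `g`-VARIABLE ON THE CENTRAL `α`-WINDOW `Ωα c U`** — the `hfwd` SHAPE of dag-n09-w6's `exists_perBondCharts_of_forwardLaws`, for EVERY environment `U`
(given an off-central index `i₀` at `c`): `Haar⌊F(Ωα) = F_*(jac·Haar⌊Ωα)` for `F(g) = Ū(U[β(c) ↦ g])(c)`, `Ωα = {g | ∀ i, dist1 (fibreFamily U c (pre·g·post) i) ≤ α}`, `jac(g) = J(pre·g·post)`
(the W-level law transported through the Haar-preserving bi-translation `g ↦ pre·g·post`, `Ū(U[β(c) ↦ g])(c) = E(pre·g·post)`).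
[cite: Balaban1987RG1, (0.4) p.253 and (2.10) p.267; Helgason2000, Ch. I §1 Thm. 1.14 (12)-(13) p. 96; Balaban1985Averaging, (10) p.19] -/
theorem forwardLaw_avgFun_update_centralWindow (hj : j + 1 ≤ P.m + P.K) (U : GaugeField P j (SU N)) (c : PBond P (j + 1)) {α : ℝ}
    (hα0 : 0 ≤ α) (hα : α ≤ 1 / 24) (hα64 : 64 * α ≤ deltaSU (Fin N)) (hgap : (BlockAveragingEMLHaarAC.offCard c : ℝ) / (Fintype.card (Idx P) : ℝ) + 150 * α < 1)
    {i₀ : Idx P} (hi₀ : ¬ IsCentral c i₀)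
    (EE : (Idx P → Matrix (Fin N) (Fin N) ℂ) → Matrix (Fin N) (Fin N) ℂ → Matrix (Fin N) (Fin N) ℂ)
    (hEE : ∀ V A, EE V A = eml (fun i : Idx P => if IsCentral c i then (1 : Matrix (Fin N) (Fin N) ℂ) else V i * star A) * A)
    (Φ : ((Idx P → Matrix (Fin N) (Fin N) ℂ) × Matrix (Fin N) (Fin N) ℂ) × (specialUnitaryLogChart (Fin N)).lie → (specialUnitaryLogChart (Fin N)).lie)
    (hΦ : ∀ p, Φ p = HaarExpChartLocal.proj (specialUnitaryLogChart (Fin N))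
      (mlog (star (EE p.1.1 p.1.2) * EE p.1.1 (p.1.2 * exp ((p.2 : (specialUnitaryLogChart (Fin N)).lie) : Matrix (Fin N) (Fin N) ℂ))))) :
    (HaarData.haar : Measure (SU N)).restrict ((fun g : SU N => avgFun (expMeanLogSU (n := Fin N)) (update U (centralBond c) g) c) ''
        {g : SU N | ∀ i : Idx P, dist1 (fibreFamily U c (pre U c * g * post U c) i) ≤ α}) =
      Measure.map (fun g : SU N => avgFun (expMeanLogSU (n := Fin N)) (update U (centralBond c) g) c)
        (((HaarData.haar : Measure (SU N)).restrict {g : SU N | ∀ i : Idx P, dist1 (fibreFamily U c (pre U c * g * post U c) i) ≤ α}).withDensity fun g =>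
          jacDensity (lie_adStable_specialUnitaryGroup (n := Fin N))
              (Φ ((fun i => ((openHol U c i : SU N) : Matrix (Fin N) (Fin N) ℂ), ((openHol U c i₀ : SU N) : Matrix (Fin N) (Fin N) ℂ)),
                (isChartRep_specialUnitaryGroup (n := Fin N)).logChart ((openHol U c i₀)⁻¹ * (pre U c * g * post U c)))) *
            ENNReal.ofReal |((fderiv ℝ Φ ((fun i => ((openHol U c i : SU N) : Matrix (Fin N) (Fin N) ℂ), ((openHol U c i₀ : SU N) : Matrix (Fin N) (Fin N) ℂ)),
                (isChartRep_specialUnitaryGroup (n := Fin N)).logChart ((openHol U c i₀)⁻¹ * (pre U c * g * post U c)))).comp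
              (ContinuousLinearMap.inr ℝ ((Idx P → Matrix (Fin N) (Fin N) ℂ) × Matrix (Fin N) (Fin N) ℂ) (specialUnitaryLogChart (Fin N)).lie)).det| /
            jacDensity (lie_adStable_specialUnitaryGroup (n := Fin N))
              ((isChartRep_specialUnitaryGroup (n := Fin N)).logChart ((openHol U c i₀)⁻¹ * (pre U c * g * post U c)))) := by
  haveI := FieldMeasureExpChartChangeOfVariables.isHaarMeasure_haar_specialUnitaryGroup (N := N)
  haveI : (HaarData.haar : Measure (SU N)).IsMulRightInvariant := FieldMeasureExpChartChangeOfVariables.isMulRightInvariant_haar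
  have hlaw := forwardLaw_fibreMap_centralWindowW (N := N) hj U c hα0 hα hα64 hgap hi₀ EE hEE Φ hΦ
  have hF : (fun g : SU N => avgFun (expMeanLogSU (n := Fin N)) (update U (centralBond c) g) c) =
      fun g : SU N => fibreMap (expMeanLogSU (n := Fin N)) U c (pre U c * g * post U c) :=
    funext fun g => avgFun_update_centralBond_self hj _ U c g
  have hEm : Measurable (fibreMap (expMeanLogSU (n := Fin N)) U c) := measurable_fibreMap _ ExpMeanLog.measurable_expMeanLogSU_E U c
  rw [hF]
  exact forwardLaw_comp_mul_mul (HaarData.haar : Measure (SU N)) (pre U c) (post U c) _ hEm hlaw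

end Law

end Summit.QuantumFields.YangMills.BalabanUVNodes.N09CentralWindowForwardLaw
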